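import Summits.ABC.ABC.Theses.FeketeScales
import Summits.ABC.ABC.Theorems.FeketeScalesSubmultOfRST

/-!
# The ε-slack form of `ScaleSubmultiplicativity` is the MEET of the crux and of abc

Crux `stmt-ABC-2160`, decl `Summit.ABC.ABC.Theses.FeketeScales.ScaleSubmultiplicativity`, route
`FeketeScales` (ABC/ABC); lead c6 helper (`--supports`), logical-position lemmas.

The ε-SLACK scale sub-multiplicativity `EpsSlackSubmult` is, verbatim, the hypothesis of the route's
support item `QuasiPolynomialAbcOfEpsSubmult` (stmt-ABC-2164): for every `ε > 0` there are `K > 0` and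
`R₀` such that every abc triple with `rad(abc) ≤ R₁R₂` (`R₁, R₂ ≥ R₀`) satisfies
`c ≤ K · (R₁R₂)^ε · c₁ c₂` for SOME abc triples `(aᵢ, bᵢ, cᵢ)` with `rad ≤ Rᵢ`.  The route file asserts
in prose (items 2160, 2164) that this form "is a CONSEQUENCE of ABC" and that the crux itself is "NOT
known to follow from ABC (needs growth control of C(ε))".  This file makes both halves kernel facts:

* `ScaleSubmultiplicativity.epsSlackSubmult_of_abc` — `ABC → EpsSlackSubmult`, with `K = 16 C(ε)`,
  `R₀ = 4`: the witnesses `(1, 2ⁿ - 1, 2ⁿ)` at the two scales have `cᵢ > Rᵢ/4`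
  (`SubmultOfRST.exists_triple_at_scale`), and `c < C(ε) rad^{1+ε} ≤ C(ε) (R₁R₂) (R₁R₂)^ε < 16 C(ε) (R₁R₂)^ε c₁c₂`.
* `ScaleSubmultiplicativity.epsSlackSubmult_of_scaleSubmultiplicativity` — `crux → EpsSlackSubmult`
  with the SAME constant `K` for every `ε` and `R₀(ε)` large: `(log P)^θ ≤ ε log P` once
  `(log P)^{1-θ} ≥ 1/ε` (`θ < 1`), so `K e^{(log P)^θ} ≤ K P^ε`.

So `EpsSlackSubmult` sits below both `ABC` and the crux, while the crux implies polynomial abc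
(stmt-ABC-2163) and `EpsSlackSubmult` only quasi-polynomial abc (stmt-ABC-2164).  Read together: the
crux is exactly the assertion that ONE vanishing schedule `ε(P) = (log P)^{θ-1}` is admissible with a
constant `K` UNIFORM in the scale, whereas abc supplies every fixed `ε` with its own, uncontrolled,
`C(ε)` — the "growth control of C(ε)" the item's docstring names (a rate `log C(ε) ≤ B ε^{-κ}` would
give the crux with `θ = κ/(κ+1)`, STRATEGY-CENSUS §S2; nothing weaker is known to).

References: route file `Summits/ABC/ABC/Theses/FeketeScales.lean` (docstrings of stmt-ABC-2160 and
stmt-ABC-2164); [RobertStewartTenenbaum2014, §1] for the sub-power slack; Mathlib only otherwise.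
-/

-- `Summit.<Summit>.<Problem>` is the mandated summit-side namespace (CONVENTIONS §2); for the
-- single-conjunct summit `ABC` the two coincide, so the duplicate `ABC.ABC` is deliberate.
set_option linter.dupNamespace false

namespace Summit.ABC.ABC.Theorems

open Literature.NumberTheory.DiophantineGeometry

/-- **ε-slack scale sub-multiplicativity from abc.**  `ABC` implies the hypothesis of
`QuasiPolynomialAbcOfEpsSubmult` (stmt-ABC-2164): for every `ε > 0`, with `C = C(ε)` from abc,
`K := 16 C` and `R₀ := 4` work — every abc triple with `rad ≤ R₁R₂` has
`c < C rad^{1+ε} ≤ C (R₁R₂)^{1+ε} < 16 C (R₁R₂)^ε c₁ c₂` for the witnesses `(1, 2ⁿ - 1, 2ⁿ)` at the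
scales `R₁, R₂` (`cᵢ > Rᵢ/4`).  The ε-slack form of the crux is therefore no stronger than abc
(route FeketeScales, docstring of stmt-ABC-2164). [folklore] -/
theorem ScaleSubmultiplicativity.epsSlackSubmult_of_abc :
    _root_.ABC → ∀ ε : ℝ, 0 < ε → ∃ K : ℝ, 0 < K ∧ ∃ R₀ : ℕ, ∀ R₁ R₂ : ℕ, R₀ ≤ R₁ → R₀ ≤ R₂ →
      ∀ a b c : ℕ, IsABCTriple a b c → rad a b c ≤ R₁ * R₂ →
      ∃ a₁ b₁ c₁ a₂ b₂ c₂ : ℕ, IsABCTriple a₁ b₁ c₁ ∧ rad a₁ b₁ c₁ ≤ R₁ ∧ IsABCTriple a₂ b₂ c₂ ∧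
        rad a₂ b₂ c₂ ≤ R₂ ∧ (c : ℝ) ≤ K * ((R₁ : ℝ) * R₂) ^ ε * c₁ * c₂ := by
  intro hABC ε hε
  obtain ⟨C, hC, hCabc⟩ := hABC ε hε
  refine ⟨16 * C, by positivity, 4, ?_⟩
  intro R₁ R₂ hR₁ hR₂ a b c habc hrad
  obtain ⟨a₁, b₁, c₁, h₁, hrad₁, hc₁⟩ := SubmultOfRST.exists_triple_at_scale hR₁
  obtain ⟨a₂, b₂, c₂, h₂, hrad₂, hc₂⟩ := SubmultOfRST.exists_triple_at_scale hR₂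
  refine ⟨a₁, b₁, c₁, a₂, b₂, c₂, h₁, hrad₁, h₂, hrad₂, ?_⟩
  set P : ℕ := R₁ * R₂ with hP_def
  have hP16 : P < 16 * (c₁ * c₂) := by
    calc P = R₁ * R₂ := rfl
      _ < (4 * c₁) * (4 * c₂) := Nat.mul_lt_mul'' hc₁ hc₂
      _ = 16 * (c₁ * c₂) := by ring
  have hPreal : ((R₁ : ℝ) * R₂) = (P : ℝ) := by rw [hP_def]; push_cast; ring
  have hP0 : (0 : ℝ) ≤ (P : ℝ) := Nat.cast_nonneg _
  have hradP : ((rad a b c : ℕ) : ℝ) ≤ (P : ℝ) := by exact_mod_cast hrad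
  have hrad0 : (0 : ℝ) ≤ ((rad a b c : ℕ) : ℝ) := Nat.cast_nonneg _
  have hP16r : (P : ℝ) ≤ 16 * ((c₁ : ℝ) * c₂) := by exact_mod_cast hP16.le
  have hPε0 : 0 ≤ (P : ℝ) ^ ε := Real.rpow_nonneg hP0 ε
  have hsplit : (P : ℝ) ^ (1 + ε) = (P : ℝ) * (P : ℝ) ^ ε := by
    rw [Real.rpow_add' hP0 (by linarith : (1 : ℝ) + ε ≠ 0), Real.rpow_one]
  calc (c : ℝ) ≤ C * ((rad a b c : ℕ) : ℝ) ^ (1 + ε) := (hCabc a b c habc).le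
    _ ≤ C * (P : ℝ) ^ (1 + ε) :=
        mul_le_mul_of_nonneg_left (Real.rpow_le_rpow hrad0 hradP (by linarith)) hC.le
    _ = C * ((P : ℝ) * (P : ℝ) ^ ε) := by rw [hsplit]
    _ ≤ C * ((16 * ((c₁ : ℝ) * c₂)) * (P : ℝ) ^ ε) :=
        mul_le_mul_of_nonneg_left (mul_le_mul_of_nonneg_right hP16r hPε0) hC.le
    _ = 16 * C * ((R₁ : ℝ) * R₂) ^ ε * c₁ * c₂ := by rw [hPreal]; ring

/-- Threshold for the sub-power slack against a power slack: for `θ < 1` and `ε > 0`, eventually in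
`P : ℕ` one has `(log P)^θ ≤ ε · log P` (since `(log P)^{1-θ} → ∞`). [folklore] -/
theorem ScaleSubmultiplicativity.exists_threshold_rpow_le_mul_log {θ ε : ℝ} (hθ : θ < 1)
    (hε : 0 < ε) : ∃ N : ℕ, ∀ P : ℕ, N ≤ P → Real.log (P : ℝ) ^ θ ≤ ε * Real.log (P : ℝ) := by
  obtain ⟨N₀, hN₀⟩ := SubmultOfRST.exists_threshold (1 / ε) (s := 1 - θ) (by linarith)
  refine ⟨max N₀ 2, fun P hP => ?_⟩
  have hPN : N₀ ≤ P := (le_max_left _ _).trans hP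
  have hP2 : (2 : ℝ) ≤ (P : ℝ) := by exact_mod_cast (le_max_right _ _).trans hP
  have hlog : 0 < Real.log (P : ℝ) := Real.log_pos (by linarith)
  have hpow : 1 / ε ≤ Real.log (P : ℝ) ^ (1 - θ) := hN₀ P hPN
  have hpow0 : 0 < Real.log (P : ℝ) ^ (1 - θ) := Real.rpow_pos_of_pos hlog _
  -- `(log P)^θ · (log P)^{1-θ} = log P`
  have hmul : Real.log (P : ℝ) ^ θ * Real.log (P : ℝ) ^ (1 - θ) = Real.log (P : ℝ) := by
    rw [← Real.rpow_add hlog]; norm_num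
  have hε1 : 1 ≤ ε * Real.log (P : ℝ) ^ (1 - θ) := by
    have := mul_le_mul_of_nonneg_left hpow hε.le
    rwa [mul_one_div_cancel hε.ne'] at this
  calc Real.log (P : ℝ) ^ θ = Real.log (P : ℝ) ^ θ * 1 := (mul_one _).symm
    _ ≤ Real.log (P : ℝ) ^ θ * (ε * Real.log (P : ℝ) ^ (1 - θ)) :=
        mul_le_mul_of_nonneg_left hε1 (Real.rpow_nonneg hlog.le θ)
    _ = ε * (Real.log (P : ℝ) ^ θ * Real.log (P : ℝ) ^ (1 - θ)) := by ring
    _ = ε * Real.log (P : ℝ) := by rw [hmul]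

/-- **ε-slack scale sub-multiplicativity from the crux.**  `ScaleSubmultiplicativity` implies the
hypothesis of `QuasiPolynomialAbcOfEpsSubmult` (stmt-ABC-2164) with the crux's constant `K` for EVERY
`ε` (only the threshold `R₀(ε)` grows): for `R₁, R₂ ≥ R₀(ε)` one has `(log R₁R₂)^θ ≤ ε log R₁R₂`,
hence `K e^{(log R₁R₂)^θ} ≤ K (R₁R₂)^ε`.  With `epsSlackSubmult_of_abc` this exhibits the ε-slack
form as a common consequence of abc and of the crux; the crux is the uniformity of `K` along the
schedule `ε(P) = (log P)^{θ-1}` (route FeketeScales, docstring of stmt-ABC-2160). [folklore] -/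
theorem ScaleSubmultiplicativity.epsSlackSubmult_of_scaleSubmultiplicativity :
    Summit.ABC.ABC.Theses.FeketeScales.ScaleSubmultiplicativity →
    ∀ ε : ℝ, 0 < ε → ∃ K : ℝ, 0 < K ∧ ∃ R₀ : ℕ, ∀ R₁ R₂ : ℕ, R₀ ≤ R₁ → R₀ ≤ R₂ →
      ∀ a b c : ℕ, IsABCTriple a b c → rad a b c ≤ R₁ * R₂ →
      ∃ a₁ b₁ c₁ a₂ b₂ c₂ : ℕ, IsABCTriple a₁ b₁ c₁ ∧ rad a₁ b₁ c₁ ≤ R₁ ∧ IsABCTriple a₂ b₂ c₂ ∧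
        rad a₂ b₂ c₂ ≤ R₂ ∧ (c : ℝ) ≤ K * ((R₁ : ℝ) * R₂) ^ ε * c₁ * c₂ := by
  rintro ⟨θ, hθ, K, hK, R₀, hR₀⟩ ε hε
  obtain ⟨N, hN⟩ := ScaleSubmultiplicativity.exists_threshold_rpow_le_mul_log hθ hε
  refine ⟨K, hK, max R₀ (max N 1), ?_⟩
  intro R₁ R₂ hR₁ hR₂ a b c habc hrad
  have hR₁0 : R₀ ≤ R₁ := (le_max_left _ _).trans hR₁
  have hR₂0 : R₀ ≤ R₂ := (le_max_left _ _).trans hR₂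
  obtain ⟨a₁, b₁, c₁, a₂, b₂, c₂, h₁, hrad₁, h₂, hrad₂, hle⟩ := hR₀ R₁ R₂ hR₁0 hR₂0 a b c habc hrad
  refine ⟨a₁, b₁, c₁, a₂, b₂, c₂, h₁, hrad₁, h₂, hrad₂, hle.trans ?_⟩
  -- the scale `P = R₁ R₂ ≥ N`, `P ≥ 1`
  set P : ℕ := R₁ * R₂ with hP_def
  have hR₂1 : 1 ≤ R₂ := ((le_max_right _ _).trans (le_max_right _ _)).trans hR₂
  have hPN : N ≤ P := by
    calc N ≤ R₁ := ((le_max_left _ _).trans (le_max_right _ _)).trans hR₁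
      _ = R₁ * 1 := (mul_one _).symm
      _ ≤ R₁ * R₂ := Nat.mul_le_mul_left R₁ hR₂1
  have hPreal : ((R₁ : ℝ) * R₂) = (P : ℝ) := by rw [hP_def]; push_cast; ring
  have hP1 : (1 : ℝ) ≤ (P : ℝ) := by
    have h1 : 1 ≤ R₁ := ((le_max_right _ _).trans (le_max_right _ _)).trans hR₁
    exact_mod_cast Nat.one_le_iff_ne_zero.mpr (Nat.mul_ne_zero (by omega) (by omega))
  have hP0 : (0 : ℝ) < (P : ℝ) := by linarith
  have hexp : Real.exp (Real.log (P : ℝ) ^ θ) ≤ (P : ℝ) ^ ε := by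
    rw [Real.rpow_def_of_pos hP0, Real.exp_le_exp, mul_comm]
    exact hN P hPN
  have hc₁ : (0 : ℝ) ≤ (c₁ : ℝ) := Nat.cast_nonneg _
  have hc₂ : (0 : ℝ) ≤ (c₂ : ℝ) := Nat.cast_nonneg _
  rw [hPreal]
  have := mul_le_mul_of_nonneg_left hexp hK.le
  calc K * Real.exp (Real.log (P : ℝ) ^ θ) * c₁ * c₂
      ≤ K * (P : ℝ) ^ ε * c₁ * c₂ :=
        mul_le_mul_of_nonneg_right (mul_le_mul_of_nonneg_right this hc₁) hc₂

end Summit.ABC.ABC.Theorems
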